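import Summits.QuantumFields.YangMills.Theorems.QuantileBitPuritySU2ClassShiftCovariance
import HarnessLib

/-!
# The axis of an `SU(2)` element is Lipschitz away from the centre: `‖axisVec W − axisVec W'‖ ≤ 2‖q_W − q_{W'}‖ / ‖Im q_W‖`

Support module (`--supports` stmt-QuantumFields-23948; memo HOME `bc/g14-dw/PLAN-PERIODIC.md` §B: «axis transport error ≲ (holonomy error)/(distance to the
centre)» — the conditioning of the own ∕ transverse axis used in every cost estimate of the translate lines).  Elementary normed-space inequality
`‖a/‖a‖ − b/‖b‖‖ ≤ 2‖a − b‖/‖a‖` (`a ≠ 0`) applied to the imaginary parts of the unit quaternions (`ClassShift.axisVec`, defs module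
`QuantileBitPuritySU2ClassShiftDefs`).  HONEST FRAMING: algebra on one compact group; nothing about lattice gauge theory, infinite volume, the continuum limit
or the Clay gap.  No `sorry`, no new axiom, no new definition.  References: [folklore].
-/

set_option autoImplicit false

noncomputable section

open scoped Real Quaternion

namespace Summit.QuantumFields.YangMills.Theorems.FemtoTransferGap.ClassShift

open Literature.MathematicalPhysics.QuantumLattice (su2Quat)

/-- **Normalisation is Lipschitz away from the origin**: `‖‖a‖⁻¹ • a − ‖b‖⁻¹ • b‖ ≤ 2‖a − b‖ / ‖a‖` for `a ≠ 0` (any real normed space; `b = 0`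
allowed with Mathlib's `0⁻¹ = 0`). [folklore] -/
theorem norm_normalize_sub_normalize_le {E : Type*} [NormedAddCommGroup E] [NormedSpace ℝ E] {a : E} (ha : a ≠ 0) (b : E) :
    ‖‖a‖⁻¹ • a - ‖b‖⁻¹ • b‖ ≤ 2 * ‖a - b‖ / ‖a‖ := by
  have ha0 : 0 < ‖a‖ := norm_pos_iff.2 ha
  by_cases hb : b = 0
  · subst hb
    rw [norm_zero, inv_zero, zero_smul, sub_zero, sub_zero, norm_smul, norm_inv, norm_norm, inv_mul_cancel₀ ha0.ne']
    rw [le_div_iff₀ ha0]; linarith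
  have hb0 : 0 < ‖b‖ := norm_pos_iff.2 hb
  -- `a/‖a‖ − b/‖b‖ = (a − b)/‖a‖ + b (1/‖a‖ − 1/‖b‖)`
  have hsplit : ‖a‖⁻¹ • a - ‖b‖⁻¹ • b = ‖a‖⁻¹ • (a - b) + (‖a‖⁻¹ - ‖b‖⁻¹) • b := by
    rw [smul_sub, sub_smul]; abel
  rw [hsplit]
  have h1 : ‖‖a‖⁻¹ • (a - b)‖ = ‖a - b‖ / ‖a‖ := by rw [norm_smul, norm_inv, norm_norm, div_eq_inv_mul]
  have h2 : ‖(‖a‖⁻¹ - ‖b‖⁻¹) • b‖ ≤ ‖a - b‖ / ‖a‖ := by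
    rw [norm_smul, Real.norm_eq_abs]
    have h3 : |‖a‖⁻¹ - ‖b‖⁻¹| * ‖b‖ = |‖b‖ - ‖a‖| / ‖a‖ := by
      rw [inv_sub_inv ha0.ne' hb0.ne', abs_div, abs_of_pos (mul_pos ha0 hb0)]
      field_simp
    rw [h3]
    exact div_le_div_of_nonneg_right ((abs_norm_sub_norm_le b a).trans (by rw [norm_sub_rev])) ha0.le
  calc ‖‖a‖⁻¹ • (a - b) + (‖a‖⁻¹ - ‖b‖⁻¹) • b‖ ≤ ‖‖a‖⁻¹ • (a - b)‖ + ‖(‖a‖⁻¹ - ‖b‖⁻¹) • b‖ := norm_add_le _ _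
    _ ≤ ‖a - b‖ / ‖a‖ + ‖a - b‖ / ‖a‖ := add_le_add h1.le h2
    _ = 2 * ‖a - b‖ / ‖a‖ := by ring

/-- `‖imVec q‖ ≤ ‖q‖` (the imaginary part is shorter than the quaternion). [folklore] -/
theorem norm_imVec_le (q : ℍ) : ‖imVec q‖ ≤ ‖q‖ := by
  have h1 : ‖imVec q‖ ^ 2 = q.imI ^ 2 + q.imJ ^ 2 + q.imK ^ 2 := by
    rw [EuclideanSpace.real_norm_sq_eq, Fin.sum_univ_three]
    simp [imVec]
  have h2 : ‖q‖ ^ 2 = q.re ^ 2 + q.imI ^ 2 + q.imJ ^ 2 + q.imK ^ 2 := by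
    rw [sq, ← Quaternion.normSq_eq_norm_mul_self, Quaternion.normSq_def']
  nlinarith [norm_nonneg (imVec q), norm_nonneg q, sq_nonneg q.re]

/-- ★ **The axis is Lipschitz away from the centre**: `‖axisVec W − axisVec W'‖ ≤ 2 ‖q_W − q_{W'}‖ / ‖imVec q_W‖` whenever `W` is not central
(`imVec q_W ≠ 0`; `q = su2Quat`, quaternion norm).  With `‖Im q_W‖ = sin(class angle)` this is the «axis error ≤ holonomy error / distance to the centre»
of the cost bookkeeping. [folklore] -/
theorem norm_axisVec_sub_le {W : Matrix.specialUnitaryGroup (Fin 2) ℂ} (hW : imVec (su2Quat W) ≠ 0) (W' : Matrix.specialUnitaryGroup (Fin 2) ℂ) :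
    ‖axisVec W - axisVec W'‖ ≤ 2 * ‖su2Quat W - su2Quat W'‖ / ‖imVec (su2Quat W)‖ := by
  unfold axisVec
  refine (norm_normalize_sub_normalize_le hW _).trans ?_
  have h0 : 0 < ‖imVec (su2Quat W)‖ := norm_pos_iff.2 hW
  refine div_le_div_of_nonneg_right ?_ h0.le
  have imVec_sub : ∀ q q' : ℍ, imVec (q - q') = imVec q - imVec q' := fun q q' => by ext i; fin_cases i <;> simp [imVec]
  rw [← imVec_sub]
  exact mul_le_mul_of_nonneg_left (norm_imVec_le _) (by norm_num)

end Summit.QuantumFields.YangMills.Theorems.FemtoTransferGap.ClassShift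

end
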